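import Summits.AtomisticToContinuum.BoseEinsteinCondensation.Theorems.BoxLatticeFSumSuperBlock
import Summits.AtomisticToContinuum.BoseEinsteinCondensation.Theorems.BoxLatticeFSumDCTParseval
import HarnessLib

/-!
# `BoxLatticeFSum` MC kernel (ii), analytic half: super-block occupations are dominated by block occupations
# (decomp-a2c · hand-1 g9)

For continuous `Ψ` on `(ℝ³)^{n+1}`, `K > 0`, `L > 0`, `ℓ = L/K` and the super-block index type `SubIdx (K/2+1)`
of `pieceMode`:
* `card_children_le` — a super-block has at most `8` child blocks (`B ↦ (B_j mod 2)_j` is injective on them);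
* `cellOccupation_superBlock_le` — `n(u^{2ℓ}_m) ≤ Σ_{B child of m} n(u_B)` (Cauchy–Schwarz on the slice
  amplitudes through `subMode_double_eq_sum_children`, then `Kinematics.cellOccupation_transfer_le`);
* `sum_cellOccupation_superBlock_le` — `Σ_m n(u^{2ℓ}_m) ≤ Σ_B n(u_B)` (every block has exactly one parent).
With `parseval_boxBlockWaves` this is MC's step `Σ_q n(g_q) = Σ_B n(u_B) ≥ Σ_m n(pieceMode 0 m)`.
No definitions, no `sorry`. [folklore]
-/

noncomputable section

open MeasureTheory Finset
open scoped BigOperators ENNReal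

namespace Summit.AtomisticToContinuum.BoseEinsteinCondensation.Theorems.BoxLatticeFSum

open Literature.MathematicalPhysics.QuantumManyBody.BoseGas
open Summit.AtomisticToContinuum.BoseEinsteinCondensation.Theses.BlockLatticeFSum

/-- A super-block has at most eight child blocks. [folklore] -/
theorem card_children_le {K K' : ℕ} (m : SubIdx K') :
    ((Finset.univ : Finset (SubIdx K)).filter (fun B => ∀ j : Fin 3, (B j : ℕ) / 2 = (m j : ℕ))).card ≤ 8 := by
  classical
  set S := (Finset.univ : Finset (SubIdx K)).filter (fun B => ∀ j : Fin 3, (B j : ℕ) / 2 = (m j : ℕ)) with hS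
  have hinj : Set.InjOn (fun B : SubIdx K => fun j : Fin 3 => (⟨(B j : ℕ) % 2, Nat.mod_lt _ two_pos⟩ : Fin 2)) ↑S := by
    intro B hB B' hB' h
    rw [Finset.coe_filter] at hB hB'
    funext j
    have h1 : (B j : ℕ) % 2 = (B' j : ℕ) % 2 := by
      have := congr_fun h j
      simpa using this
    have h2 : (B j : ℕ) / 2 = (B' j : ℕ) / 2 := by rw [hB.2 j, hB'.2 j]
    exact Fin.ext (by omega)
  have h := Finset.card_le_card_of_injOn _ (fun B _ => Finset.mem_univ _) hinj
  simpa [Fintype.card_fun, Fintype.card_fin] using h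

/-- Cauchy–Schwarz for a finite family in `ℂ`: `‖Σ_{i∈s} a_i‖² ≤ |s| Σ_{i∈s} ‖a_i‖²`. [folklore] -/
theorem norm_sum_sq_le_card_mul {ι : Type*} (s : Finset ι) (a : ι → ℂ) :
    ‖∑ i ∈ s, a i‖ ^ 2 ≤ (s.card : ℝ) * ∑ i ∈ s, ‖a i‖ ^ 2 := by
  have h1 : ‖∑ i ∈ s, a i‖ ≤ ∑ i ∈ s, ‖a i‖ := norm_sum_le _ _
  have h2 : (∑ i ∈ s, ‖a i‖) ^ 2 ≤ (s.card : ℝ) * ∑ i ∈ s, ‖a i‖ ^ 2 := by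
    have h := Finset.sum_mul_sq_le_sq_mul_sq s (fun _ => (1 : ℝ)) (fun i => ‖a i‖)
    simp only [one_pow, Finset.sum_const, nsmul_eq_mul, mul_one, one_mul] at h
    exact h
  calc ‖∑ i ∈ s, a i‖ ^ 2 ≤ (∑ i ∈ s, ‖a i‖) ^ 2 := by
        exact pow_le_pow_left₀ (norm_nonneg _) h1 2
    _ ≤ _ := h2

/-- **Super-block occupation ≤ sum of child block occupations**: for continuous `Ψ`, `K > 0`, `L > 0`,
`m : SubIdx (K/2+1)`,
`cellOccupation (n+1) L (subMode (2L/K) m) Ψ ≤ Σ_{B child of m} cellOccupation (n+1) L (subMode (L/K) B) Ψ`.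
[folklore] -/
theorem cellOccupation_superBlock_le {n K : ℕ} {L : ℝ} (hK : 0 < K) (hL : 0 < L) (m : SubIdx (K / 2 + 1))
    {Ψ : Config (n + 1) → ℂ} (hΨ : Continuous Ψ) :
    cellOccupation (n + 1) L (subMode (2 * (L / (K : ℝ))) m) Ψ ≤
      ∑ B ∈ (Finset.univ : Finset (SubIdx K)).filter (fun B => ∀ j : Fin 3, (B j : ℕ) / 2 = (m j : ℕ)),
        cellOccupation (n + 1) L (subMode (L / (K : ℝ)) B) Ψ := by
  classical
  set S := (Finset.univ : Finset (SubIdx K)).filter (fun B => ∀ j : Fin 3, (B j : ℕ) / 2 = (m j : ℕ)) with hS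
  have h := Kinematics.cellOccupation_transfer_le (L := L) ({m} : Finset (SubIdx (K / 2 + 1))) S
    (fun _ => (1 : ℝ)) (fun _ => (1 : ℝ)) (fun _ _ => zero_le_one) (fun _ _ => zero_le_one)
    (fun m' : SubIdx (K / 2 + 1) => subMode (2 * (L / (K : ℝ))) m') (fun B : SubIdx K => subMode (L / (K : ℝ)) B)
    (fun m' => measurable_subMode _ m') (fun B => measurable_subMode _ B) hΨ ?_
  · simpa using h
  intro Y _
  simp only [Finset.sum_singleton, one_mul]
  -- rewrite the super-block amplitude through the children
  have hmode : modeAn L (subMode (2 * (L / (K : ℝ))) m) Ψ Y =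
      ((Real.sqrt 8)⁻¹ : ℂ) * ∑ B ∈ S, modeAn L (subMode (L / (K : ℝ)) B) Ψ Y := by
    rw [Kinematics.modeAn_congr_on_cell (fun x hx => subMode_double_eq_sum_children hK hL m x hx) Ψ Y]
    rw [Kinematics.modeAn_const_mul_mode]
    have hsum := Kinematics.modeAn_finset_sum_mode (L := L) S (fun _ => (1 : ℂ))
      (fun B => subMode (L / (K : ℝ)) B) (fun B => measurable_subMode _ B)
      (fun B => ⟨_, fun x => norm_subMode_le _ B x⟩) hΨ Y
    simp only [one_mul, map_one] at hsum
    rw [hsum]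
    congr 1
    rw [map_inv₀, Complex.conj_ofReal]
  rw [hmode, norm_mul, mul_pow, norm_inv, Complex.norm_real, Real.norm_of_nonneg (Real.sqrt_nonneg _),
    inv_pow, Real.sq_sqrt (by norm_num : (0 : ℝ) ≤ 8)]
  have hcs := norm_sum_sq_le_card_mul S (fun B => modeAn L (subMode (L / (K : ℝ)) B) Ψ Y)
  have hcard : (S.card : ℝ) ≤ 8 := by exact_mod_cast card_children_le (K := K) m
  have hnn : 0 ≤ ∑ B ∈ S, ‖modeAn L (subMode (L / (K : ℝ)) B) Ψ Y‖ ^ 2 :=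
    Finset.sum_nonneg fun B _ => sq_nonneg _
  calc (8 : ℝ)⁻¹ * ‖∑ B ∈ S, modeAn L (subMode (L / (K : ℝ)) B) Ψ Y‖ ^ 2
      ≤ (8 : ℝ)⁻¹ * ((S.card : ℝ) * ∑ B ∈ S, ‖modeAn L (subMode (L / (K : ℝ)) B) Ψ Y‖ ^ 2) := by
        gcongr
    _ ≤ (8 : ℝ)⁻¹ * (8 * ∑ B ∈ S, ‖modeAn L (subMode (L / (K : ℝ)) B) Ψ Y‖ ^ 2) := by
        gcongr
    _ = ∑ B ∈ S, ‖modeAn L (subMode (L / (K : ℝ)) B) Ψ Y‖ ^ 2 := by ring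

/-- **Total super-block occupation ≤ total block occupation**: every block has exactly one parent
super-block index in `SubIdx (K/2+1)`, so summing `cellOccupation_superBlock_le` over `m` and re-assembling
the children fibrewise gives `Σ_m n(u^{2ℓ}_m) ≤ Σ_B n(u_B)`. [folklore] -/
theorem sum_cellOccupation_superBlock_le {n K : ℕ} {L : ℝ} (hK : 0 < K) (hL : 0 < L)
    {Ψ : Config (n + 1) → ℂ} (hΨ : Continuous Ψ) :
    ∑ m : SubIdx (K / 2 + 1), cellOccupation (n + 1) L (subMode (2 * (L / (K : ℝ))) m) Ψ ≤
      ∑ B : SubIdx K, cellOccupation (n + 1) L (subMode (L / (K : ℝ)) B) Ψ := by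
  classical
  -- the parent map
  set parent : SubIdx K → SubIdx (K / 2 + 1) := fun B j =>
    ⟨(B j : ℕ) / 2, by have := (B j).isLt; omega⟩ with hparent
  have hfib : ∀ m : SubIdx (K / 2 + 1),
      (Finset.univ : Finset (SubIdx K)).filter (fun B => ∀ j : Fin 3, (B j : ℕ) / 2 = (m j : ℕ)) =
        (Finset.univ : Finset (SubIdx K)).filter (fun B => parent B = m) := by
    intro m
    ext B
    simp only [Finset.mem_filter, Finset.mem_univ, true_and]
    constructor
    · intro h; funext j; exact Fin.ext (h j)
    · intro h j; rw [← h]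
  calc ∑ m : SubIdx (K / 2 + 1), cellOccupation (n + 1) L (subMode (2 * (L / (K : ℝ))) m) Ψ
      ≤ ∑ m : SubIdx (K / 2 + 1), ∑ B ∈ (Finset.univ : Finset (SubIdx K)).filter (fun B => parent B = m),
          cellOccupation (n + 1) L (subMode (L / (K : ℝ)) B) Ψ := by
        refine Finset.sum_le_sum fun m _ => ?_
        rw [← hfib m]
        exact cellOccupation_superBlock_le hK hL m hΨ
    _ = ∑ B : SubIdx K, cellOccupation (n + 1) L (subMode (L / (K : ℝ)) B) Ψ :=
        Finset.sum_fiberwise_of_maps_to (fun B _ => Finset.mem_univ (parent B)) _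

end Summit.AtomisticToContinuum.BoseEinsteinCondensation.Theorems.BoxLatticeFSum

end
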